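import Summits.RiemannHypothesis.RiemannHypothesis.Theorems.SoloInformedGroundStateWindowQuant

/-!
# Handoff (rh-explicit, prove-1), Route E: the window test with the leak window ending at `u = 1/λ`

Solo's part IX/XV window (`winFn`, `winTest`, cutoff `χ_λ` with transition on `[1/(λ+1), 2/(λ+1)]`)
sees, after Poisson summation, seed frequencies down to `≈ λ²/2`; for a CONCENTRATED seed this halves
the exponent of the resulting ground-energy bound (handoff/idea-1 IDEAS-prolate §38.4 (S1);
handoff/prove-1 ATTEMPT-10 §3).  This file is the variant with a two-parameter cutoff
`χ_{λ,θ}(u) = smoothTransition((λu − θ)/(1 − θ))`, `0 < θ < 1`: `= 0` on `λu ≤ θ`, `= 1` on `λu ≥ 1`.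
The tail then lives on `(0, 1/λ]`, where the Poisson step (`norm_eMapFn_le_of_fourier_decay` with
threshold `X = λ²`) applies at full strength, and the window test is supported in
`[-(log λ − log θ), log λ − log θ]`.  Everything is Solo's parts IX and XV with the cutoff replaced;
the quantitative outputs are

* `norm_weilMellin_winTestW_le_of_bound`: `‖ĝ(ρ)‖ ≤ A'/λ²` at every non-trivial zero, from
  `‖E(u)‖ ≤ A' u/λ` on `0 < u ≤ 1/λ` (no hypothesis on the zeros; the steepness `θ` never enters);
* `norm_weilMellin_winTestW_two_ge_of_bound`: `‖ĝ(2)‖ ≥ (π²/6)‖𝓜h(2)‖λ² − A'/λ²`.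

These are the window inputs of the cell's paper Theorem E♭ (handoff/prove-1 ATTEMPT-11). Nothing here
bears on RH.
-/

set_option linter.dupNamespace false  -- the mandated namespace repeats `RiemannHypothesis`

noncomputable section

open Complex Filter Set Topology MeasureTheory
open Literature.NumberTheory.LFunctions

namespace Summit.RiemannHypothesis.RiemannHypothesis.Theorems.HandoffRouteE

open Summit.RiemannHypothesis.RiemannHypothesis.Theorems

/-! ## The two-parameter cutoff -/

/-- The smooth cutoff `χ_{λ,θ}(u) = smoothTransition((λu − θ)/(1 − θ))` [Solo IX, transition moved to
`[θ/λ, 1/λ]`]. -/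
def cutW (lam θ u : ℝ) : ℝ := Real.smoothTransition ((lam * u - θ) / (1 - θ))

/-- `χ = 0` on `λu ≤ θ` (`θ < 1`). -/
theorem cutW_eq_zero {lam θ u : ℝ} (hθ : θ < 1) (hu : lam * u ≤ θ) : cutW lam θ u = 0 :=
  Real.smoothTransition.zero_of_nonpos (div_nonpos_of_nonpos_of_nonneg (by linarith) (by linarith))

/-- `χ = 1` on `1 ≤ λu` (`θ < 1`). -/
theorem cutW_eq_one {lam θ u : ℝ} (hθ : θ < 1) (hu : 1 ≤ lam * u) : cutW lam θ u = 1 :=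
  Real.smoothTransition.one_of_one_le ((one_le_div (by linarith)).2 (by linarith))

/-- `0 ≤ χ`. -/
theorem cutW_nonneg (lam θ u : ℝ) : 0 ≤ cutW lam θ u := Real.smoothTransition.nonneg _

/-- `χ ≤ 1`. -/
theorem cutW_le_one (lam θ u : ℝ) : cutW lam θ u ≤ 1 := Real.smoothTransition.le_one _

/-- Continuity of `χ`. -/
theorem continuous_cutW (lam θ : ℝ) : Continuous (cutW lam θ) :=
  Real.smoothTransition.continuous.comp
    (((continuous_const.mul continuous_id).sub continuous_const).div_const _)

/-! ## Window part and tail part -/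

/-- The window part `G = χ_{λ,θ} E`. -/
def winFnW (h : SchwartzMap ℝ ℂ) (lam θ : ℝ) (u : ℝ) : ℂ := (cutW lam θ u : ℂ) * eMapFn h lam u

/-- The tail part `F = (1 − χ_{λ,θ}) E`. -/
def tailFnW (h : SchwartzMap ℝ ℂ) (lam θ : ℝ) (u : ℝ) : ℂ :=
  ((1 - cutW lam θ u : ℝ) : ℂ) * eMapFn h lam u

/-- `E = G + F`. -/
theorem eMapFn_eq_winFnW_add_tailFnW (h : SchwartzMap ℝ ℂ) (lam θ u : ℝ) :
    eMapFn h lam u = winFnW h lam θ u + tailFnW h lam θ u := by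
  unfold winFnW tailFnW
  push_cast
  ring

/-- `‖G‖ ≤ ‖E‖`. -/
theorem norm_winFnW_le (h : SchwartzMap ℝ ℂ) (lam θ u : ℝ) :
    ‖winFnW h lam θ u‖ ≤ ‖eMapFn h lam u‖ := by
  unfold winFnW
  rw [norm_mul, Complex.norm_real, Real.norm_of_nonneg (cutW_nonneg lam θ u)]
  exact mul_le_of_le_one_left (norm_nonneg _) (cutW_le_one lam θ u)

/-- `‖F‖ ≤ ‖E‖`. -/
theorem norm_tailFnW_le (h : SchwartzMap ℝ ℂ) (lam θ u : ℝ) :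
    ‖tailFnW h lam θ u‖ ≤ ‖eMapFn h lam u‖ := by
  unfold tailFnW
  rw [norm_mul, Complex.norm_real,
    Real.norm_of_nonneg (by linarith [cutW_le_one lam θ u] : (0 : ℝ) ≤ 1 - cutW lam θ u)]
  exact mul_le_of_le_one_left (norm_nonneg _) (by linarith [cutW_nonneg lam θ u])

/-- `G = 0` on `λu ≤ θ`. -/
theorem winFnW_eq_zero_of_le (h : SchwartzMap ℝ ℂ) {lam θ u : ℝ} (hθ : θ < 1)
    (hu : lam * u ≤ θ) : winFnW h lam θ u = 0 := by
  unfold winFnW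
  rw [cutW_eq_zero hθ hu, Complex.ofReal_zero, zero_mul]

/-- `F = 0` on `1 ≤ λu`. -/
theorem tailFnW_eq_zero_of_le (h : SchwartzMap ℝ ℂ) {lam θ u : ℝ} (hθ : θ < 1)
    (hu : 1 ≤ lam * u) : tailFnW h lam θ u = 0 := by
  unfold tailFnW
  rw [cutW_eq_one hθ hu, sub_self, Complex.ofReal_zero, zero_mul]

/-- `G = 0` on `u ≤ 0`. -/
theorem winFnW_of_nonpos (h : SchwartzMap ℝ ℂ) (lam θ : ℝ) {u : ℝ} (hu : u ≤ 0) :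
    winFnW h lam θ u = 0 := by
  unfold winFnW
  rw [eMapFn_of_nonpos h lam hu, mul_zero]

/-- `F = 0` on `u ≤ 0`. -/
theorem tailFnW_of_nonpos (h : SchwartzMap ℝ ℂ) (lam θ : ℝ) {u : ℝ} (hu : u ≤ 0) :
    tailFnW h lam θ u = 0 := by
  unfold tailFnW
  rw [eMapFn_of_nonpos h lam hu, mul_zero]

/-- `G = 0` beyond `λ` for a seed supported in `(-∞, 1]`. -/
theorem winFnW_eq_zero_of_lt (h : SchwartzMap ℝ ℂ) (hsupp : ∀ x : ℝ, 1 < x → h x = 0)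
    {lam : ℝ} (hlam : 0 < lam) (θ : ℝ) {u : ℝ} (hu : lam < u) : winFnW h lam θ u = 0 := by
  unfold winFnW
  rw [eMapFn_eq_zero_of_lt h hsupp hlam hu, mul_zero]

/-- `F = 0` beyond `λ` for a seed supported in `(-∞, 1]`. -/
theorem tailFnW_eq_zero_of_lt (h : SchwartzMap ℝ ℂ) (hsupp : ∀ x : ℝ, 1 < x → h x = 0)
    {lam : ℝ} (hlam : 0 < lam) (θ : ℝ) {u : ℝ} (hu : lam < u) : tailFnW h lam θ u = 0 := by
  unfold tailFnW
  rw [eMapFn_eq_zero_of_lt h hsupp hlam hu, mul_zero]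

/-- Measurability of `G`. -/
theorem aestronglyMeasurable_winFnW (h : SchwartzMap ℝ ℂ) {lam : ℝ} (hlam : 0 < lam) (θ : ℝ) :
    AEStronglyMeasurable (winFnW h lam θ) volume :=
  (Complex.continuous_ofReal.comp (continuous_cutW lam θ)).aestronglyMeasurable.mul
    (aestronglyMeasurable_eMapFn h hlam)

/-- Measurability of `F`. -/
theorem aestronglyMeasurable_tailFnW (h : SchwartzMap ℝ ℂ) {lam : ℝ} (hlam : 0 < lam) (θ : ℝ) :
    AEStronglyMeasurable (tailFnW h lam θ) volume :=
  (Complex.continuous_ofReal.comp (continuous_const.sub (continuous_cutW lam θ))).aestronglyMeasurable.mul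
    (aestronglyMeasurable_eMapFn h hlam)

section moments

variable (h : SchwartzMap ℝ ℂ) (heven : ∀ x, h (-x) = h x) (h0 : h 0 = 0)
  (hint : ∫ x : ℝ, h x = 0) (hsupp : ∀ x : ℝ, 1 < x → h x = 0)
include heven h0 hint hsupp

/-- Mellin convergence of `G` on `0 < Re s`. -/
theorem mellinConvergent_winFnW {lam : ℝ} (hlam : 0 < lam) (θ : ℝ) {s : ℂ} (hs : 0 < s.re) :
    MellinConvergent (winFnW h lam θ) s := by
  obtain ⟨C, -, hC⟩ := norm_eMapFn_le_const h heven h0 hint hsupp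
  refine mellinConvergent_of_bdd_of_eq_zero (U := lam + 1) (aestronglyMeasurable_winFnW h hlam θ)
    (fun u => (norm_winFnW_le h lam θ u).trans (hC lam hlam u)) (fun u hu => ?_) hs
  rcases le_or_gt u 0 with hu' | hu'
  · exact winFnW_of_nonpos h lam θ hu'
  · have : lam + 1 < u := by
      by_contra hle
      exact hu ⟨hu', not_lt.1 hle⟩
    exact winFnW_eq_zero_of_lt h hsupp hlam θ (by linarith)

/-- Mellin convergence of `F` on `0 < Re s`. -/
theorem mellinConvergent_tailFnW {lam : ℝ} (hlam : 0 < lam) (θ : ℝ) {s : ℂ} (hs : 0 < s.re) :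
    MellinConvergent (tailFnW h lam θ) s := by
  obtain ⟨C, -, hC⟩ := norm_eMapFn_le_const h heven h0 hint hsupp
  refine mellinConvergent_of_bdd_of_eq_zero (U := lam + 1) (aestronglyMeasurable_tailFnW h hlam θ)
    (fun u => (norm_tailFnW_le h lam θ u).trans (hC lam hlam u)) (fun u hu => ?_) hs
  rcases le_or_gt u 0 with hu' | hu'
  · exact tailFnW_of_nonpos h lam θ hu'
  · have : lam + 1 < u := by
      by_contra hle
      exact hu ⟨hu', not_lt.1 hle⟩
    exact tailFnW_eq_zero_of_lt h hsupp hlam θ (by linarith)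

/-- `𝓜G = 𝓜E − 𝓜F` on `0 < Re s`. -/
theorem mellin_winFnW_eq {lam : ℝ} (hlam : 0 < lam) (θ : ℝ) {s : ℂ} (hs : 0 < s.re) :
    mellin (winFnW h lam θ) s = mellin (eMapFn h lam) s - mellin (tailFnW h lam θ) s := by
  have h1 : MellinConvergent (eMapFn h lam) s := mellinConvergent_eMapFn h heven h0 hint hsupp hlam hs
  have h2 : MellinConvergent (tailFnW h lam θ) s :=
    mellinConvergent_tailFnW h heven h0 hint hsupp hlam θ hs
  unfold mellin
  rw [← integral_sub h1 h2]
  refine setIntegral_congr_fun measurableSet_Ioi fun u _ => ?_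
  simp only [eMapFn_eq_winFnW_add_tailFnW h lam θ u, smul_eq_mul]
  unfold winFnW tailFnW
  ring

/-- **`𝓜G(ρ) = −𝓜F(ρ)` at the zeros** (E-map Mellin vanishing, Solo VII). -/
theorem mellin_winFnW_eq_neg {lam : ℝ} (hlam : 0 < lam) (θ : ℝ) {ρ : ℂ} (hρ : 0 < ρ.re)
    (hρ1 : ρ ≠ 1) (hζ : riemannZeta ρ = 0) :
    mellin (winFnW h lam θ) ρ = -mellin (tailFnW h lam θ) ρ := by
  rw [mellin_winFnW_eq h heven h0 hint hsupp hlam θ hρ,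
    mellin_eMapFn_eq_zero_of_riemannZeta_eq_zero h heven h0 hint hsupp hlam hρ hρ1 hζ, zero_sub]

omit heven h0 hint hsupp in
/-- **Quantitative tail bound**: if `‖E(u)‖ ≤ A' u/λ` for `0 < u ≤ 1/λ` (`λ ≥ 1`, `θ < 1`), then
`‖𝓜F(s)‖ ≤ A'/λ²` for every `s` with `Re s > 0`. -/
theorem norm_mellin_tailFnW_le_of_bound {A' lam θ : ℝ} (hA' : 0 ≤ A') (hlam : 1 ≤ lam)
    (hθ : θ < 1) (hE : ∀ u : ℝ, 0 < u → u ≤ lam⁻¹ → ‖eMapFn h lam u‖ ≤ A' * (lam⁻¹ * u))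
    {s : ℂ} (hs : 0 < s.re) :
    ‖mellin (tailFnW h lam θ) s‖ ≤ A' / lam ^ 2 := by
  have hlam0 : 0 < lam := by linarith
  set U : ℝ := lam⁻¹ with hU
  have hU0 : 0 < U := by positivity
  have hU1 : U ≤ 1 := by rw [hU]; exact inv_le_one_of_one_le₀ hlam
  have hM : 0 ≤ A' * lam⁻¹ := by positivity
  have hb : ∀ u : ℝ, 0 < u → u ≤ U → ‖tailFnW h lam θ u‖ ≤ A' * lam⁻¹ * u ^ (1 : ℝ) := by
    intro u hu huU
    calc ‖tailFnW h lam θ u‖ ≤ ‖eMapFn h lam u‖ := norm_tailFnW_le h lam θ u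
      _ ≤ A' * (lam⁻¹ * u) := hE u hu huU
      _ = A' * lam⁻¹ * u ^ (1 : ℝ) := by rw [Real.rpow_one]; ring
  have hz : ∀ u : ℝ, U < u → tailFnW h lam θ u = 0 := by
    intro u hu
    refine tailFnW_eq_zero_of_le h hθ ?_
    have hUe : lam * U = 1 := by rw [hU]; field_simp
    calc (1 : ℝ) = lam * U := hUe.symm
      _ ≤ lam * u := mul_le_mul_of_nonneg_left hu.le hlam0.le
  have hKs : 0 < 1 + s.re := by linarith
  have key := norm_mellin_le_of_pow_decay hU0 zero_le_one hb hz hs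
  have hUp : U ^ (1 + s.re) ≤ U := by
    calc U ^ (1 + s.re) ≤ U ^ (1 : ℝ) := Real.rpow_le_rpow_of_exponent_ge hU0 hU1 (by linarith)
      _ = U := Real.rpow_one U
  have h1 : A' * lam⁻¹ * U ^ (1 + s.re) / (1 + s.re) ≤ A' * lam⁻¹ * U ^ (1 + s.re) :=
    div_le_self (by positivity) (by linarith)
  have h2 : A' * lam⁻¹ * U ^ (1 + s.re) ≤ A' * lam⁻¹ * U := mul_le_mul_of_nonneg_left hUp hM
  have h3 : A' * lam⁻¹ * U = A' / lam ^ 2 := by rw [hU]; field_simp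
  linarith

end moments

/-! ## The window test function on the additive line -/

/-- `g(t) = e^{t/2} G(e^t)`. -/
def winTestW (h : SchwartzMap ℝ ℂ) (lam θ : ℝ) (t : ℝ) : ℂ :=
  (Real.exp (t / 2) : ℂ) * winFnW h lam θ (Real.exp t)

/-- Continuity of `g`. -/
theorem continuous_winTestW (h : SchwartzMap ℝ ℂ) {lam : ℝ} (hlam : 0 < lam) (θ : ℝ) :
    Continuous (winTestW h lam θ) := by
  have h1 : Continuous fun t : ℝ => eMapFn h lam (Real.exp t) :=
    (continuousOn_eMapFn h hlam).comp_continuous Real.continuous_exp fun t => Real.exp_pos t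
  have h2 : Continuous fun t : ℝ => (cutW lam θ (Real.exp t) : ℂ) :=
    Complex.continuous_ofReal.comp ((continuous_cutW lam θ).comp Real.continuous_exp)
  have h3 : Continuous fun t : ℝ => (Real.exp (t / 2) : ℂ) :=
    Complex.continuous_ofReal.comp (Real.continuous_exp.comp (continuous_id.div_const 2))
  unfold winTestW winFnW
  exact h3.mul (h2.mul h1)

/-- `g` vanishes for `|t| > log λ − log θ` (`λ ≥ 1`, `0 < θ < 1`). -/
theorem winTestW_eq_zero (h : SchwartzMap ℝ ℂ) (hsupp : ∀ x : ℝ, 1 < x → h x = 0)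
    {lam θ : ℝ} (hlam : 1 ≤ lam) (hθ0 : 0 < θ) (hθ1 : θ < 1) {t : ℝ}
    (ht : Real.log lam - Real.log θ < |t|) : winTestW h lam θ t = 0 := by
  unfold winTestW
  have hlam0 : 0 < lam := by linarith
  have hlogθ : Real.log θ < 0 := Real.log_neg hθ0 hθ1
  rcases le_or_gt 0 t with h0t | h0t
  · rw [abs_of_nonneg h0t] at ht
    have hlt : lam < Real.exp t := by
      have h1 : Real.log lam < t := by linarith
      have := Real.exp_lt_exp.2 h1
      rwa [Real.exp_log hlam0] at this
    rw [winFnW_eq_zero_of_lt h hsupp hlam0 θ hlt, mul_zero]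
  · rw [abs_of_neg h0t] at ht
    have hle : lam * Real.exp t ≤ θ := by
      have h1 : t < Real.log θ - Real.log lam := by linarith
      have h2 : Real.exp t < Real.exp (Real.log θ - Real.log lam) := Real.exp_lt_exp.2 h1
      rw [Real.exp_sub, Real.exp_log hθ0, Real.exp_log hlam0] at h2
      have h3 := mul_lt_mul_of_pos_left h2 hlam0
      rw [mul_div_cancel₀ _ hlam0.ne'] at h3
      exact h3.le
    rw [winFnW_eq_zero_of_le h hθ1 hle, mul_zero]

/-- Support of `g`. -/
theorem tsupport_winTestW_subset (h : SchwartzMap ℝ ℂ) (hsupp : ∀ x : ℝ, 1 < x → h x = 0)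
    {lam θ : ℝ} (hlam : 1 ≤ lam) (hθ0 : 0 < θ) (hθ1 : θ < 1) :
    tsupport (winTestW h lam θ) ⊆
      Icc (-(Real.log lam - Real.log θ)) (Real.log lam - Real.log θ) := by
  have ha : 0 ≤ Real.log lam - Real.log θ := by
    have := Real.log_nonneg hlam
    have := Real.log_neg hθ0 hθ1
    linarith
  refine closure_minimal (fun t ht => ?_) isClosed_Icc
  by_contra habs
  refine ht (winTestW_eq_zero h hsupp hlam hθ0 hθ1 ?_)
  rcases le_or_gt 0 t with h0 | h0
  · rw [abs_of_nonneg h0]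
    by_contra hle
    exact habs ⟨by linarith [not_lt.1 hle], not_lt.1 hle⟩
  · rw [abs_of_neg h0]
    by_contra hle
    exact habs ⟨by linarith [not_lt.1 hle], by linarith [not_lt.1 hle]⟩

/-- Compact support of `g`. -/
theorem hasCompactSupport_winTestW (h : SchwartzMap ℝ ℂ) (hsupp : ∀ x : ℝ, 1 < x → h x = 0)
    {lam θ : ℝ} (hlam : 1 ≤ lam) (hθ0 : 0 < θ) (hθ1 : θ < 1) :
    HasCompactSupport (winTestW h lam θ) :=
  HasCompactSupport.of_support_subset_isCompact isCompact_Icc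
    (subset_tsupport _ |>.trans (tsupport_winTestW_subset h hsupp hlam hθ0 hθ1))

/-- **`ĝ = 𝓜G`** (substitution `u = e^t`; proof verbatim from Solo IX `weilMellin_winTest`). -/
theorem weilMellin_winTestW (h : SchwartzMap ℝ ℂ) (lam θ : ℝ) (s : ℂ) :
    weilMellin (winTestW h lam θ) s = mellin (winFnW h lam θ) s := by
  unfold weilMellin mellin
  have himage : Real.exp '' univ = Ioi (0 : ℝ) := by rw [image_univ, Real.range_exp]
  rw [← himage, integral_image_eq_integral_abs_deriv_smul MeasurableSet.univ
      (fun x _ => (Real.hasDerivAt_exp x).hasDerivWithinAt) Real.exp_injective.injOn,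
    Measure.restrict_univ]
  refine integral_congr_ae (Eventually.of_forall fun t => ?_)
  have hcpow : ((Real.exp t : ℝ) : ℂ) ^ (s - 1) = cexp ((s - 1) * t) := by
    rw [Complex.ofReal_exp, Complex.cpow_def_of_ne_zero (Complex.exp_ne_zero _),
      Complex.log_exp (by rw [Complex.ofReal_im]; linarith [Real.pi_pos])
        (by rw [Complex.ofReal_im]; exact Real.pi_pos.le), mul_comm]
  simp only [winTestW]
  rw [hcpow, Complex.real_smul, smul_eq_mul, abs_of_pos (Real.exp_pos t), Complex.ofReal_exp,
    Complex.ofReal_exp]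
  have e1 : cexp (((t / 2 : ℝ)) : ℂ) * cexp ((s - 1 / 2) * (t : ℂ)) =
      cexp (t : ℂ) * cexp ((s - 1) * (t : ℂ)) := by
    rw [← Complex.exp_add, ← Complex.exp_add]
    congr 1
    push_cast
    ring
  calc cexp ((t / 2 : ℝ) : ℂ) * winFnW h lam θ (Real.exp t) * cexp ((s - 1 / 2) * (t : ℂ))
      = cexp ((t / 2 : ℝ) : ℂ) * cexp ((s - 1 / 2) * (t : ℂ)) * winFnW h lam θ (Real.exp t) := by ring
    _ = cexp (t : ℂ) * cexp ((s - 1) * (t : ℂ)) * winFnW h lam θ (Real.exp t) := by rw [e1]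
    _ = cexp (t : ℂ) * (cexp ((s - 1) * (t : ℂ)) * winFnW h lam θ (Real.exp t)) := by ring

section quant

variable (h : SchwartzMap ℝ ℂ) (heven : ∀ x, h (-x) = h x) (h0 : h 0 = 0)
  (hint : ∫ x : ℝ, h x = 0) (hsupp : ∀ x : ℝ, 1 < x → h x = 0)
include heven h0 hint hsupp

/-- **THE WINDOW TEST IS SMALL AT EVERY ZERO** [Solo XV with the new window]: under
`‖E(u)‖ ≤ A' u/λ` on `0 < u ≤ 1/λ`, `‖ĝ(ρ)‖ ≤ A'/λ²` at every non-trivial zero `ρ` — wherever it lies,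
and independently of `θ`. -/
theorem norm_weilMellin_winTestW_le_of_bound {A' lam θ : ℝ} (hA' : 0 ≤ A') (hlam : 1 ≤ lam)
    (hθ : θ < 1) (hE : ∀ u : ℝ, 0 < u → u ≤ lam⁻¹ → ‖eMapFn h lam u‖ ≤ A' * (lam⁻¹ * u))
    {ρ : ℂ} (hρ : ρ ∈ ZetaZeros.riemannZetaNontrivialZeros) :
    ‖weilMellin (winTestW h lam θ) ρ‖ ≤ A' / lam ^ 2 := by
  obtain ⟨hζ, hre, hre1⟩ := mem_riemannZetaNontrivialZeros_iff_holds.1 hρ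
  have hρ1 : ρ ≠ 1 := by
    rintro rfl
    simp at hre1
  rw [weilMellin_winTestW, mellin_winFnW_eq_neg h heven h0 hint hsupp (by linarith) θ hre hρ1 hζ,
    norm_neg]
  exact norm_mellin_tailFnW_le_of_bound h hA' hlam hθ hE hre

/-- **THE WINDOW TEST IS LARGE AT `s = 2`** [Solo XV with the new window]:
`‖ĝ(2)‖ ≥ (π²/6)‖𝓜h(2)‖λ² − A'/λ²`. -/
theorem norm_weilMellin_winTestW_two_ge_of_bound {A' lam θ : ℝ} (hA' : 0 ≤ A') (hlam : 1 ≤ lam)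
    (hθ : θ < 1) (hE : ∀ u : ℝ, 0 < u → u ≤ lam⁻¹ → ‖eMapFn h lam u‖ ≤ A' * (lam⁻¹ * u)) :
    Real.pi ^ 2 / 6 * ‖mellin (fun x : ℝ => h x) 2‖ * lam ^ 2 - A' / lam ^ 2
      ≤ ‖weilMellin (winTestW h lam θ) 2‖ := by
  have hlam0 : 0 < lam := by linarith
  have h2 : 0 < (2 : ℂ).re := by norm_num
  have h2' : 1 < (2 : ℂ).re := by norm_num
  rw [weilMellin_winTestW, mellin_winFnW_eq h heven h0 hint hsupp hlam0 θ h2,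
    mellin_eMapFn_eq h hlam0 h2', riemannZeta_two]
  set A : ℂ := (lam : ℂ) ^ (2 : ℂ) * ((Real.pi : ℂ) ^ 2 / 6) * mellin (fun x : ℝ => h x) 2
  set B : ℂ := mellin (tailFnW h lam θ) 2
  have hB : ‖B‖ ≤ A' / lam ^ 2 := norm_mellin_tailFnW_le_of_bound h hA' hlam hθ hE h2
  have hA : ‖A‖ = Real.pi ^ 2 / 6 * ‖mellin (fun x : ℝ => h x) 2‖ * lam ^ 2 := by
    have hn : ‖(lam : ℂ) ^ (2 : ℂ)‖ = lam ^ 2 := by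
      rw [Complex.norm_cpow_eq_rpow_re_of_pos hlam0, show (2 : ℂ).re = (2 : ℝ) by norm_num,
        Real.rpow_two]
    have hπ : ‖((Real.pi : ℂ) ^ 2 / 6)‖ = Real.pi ^ 2 / 6 := by
      rw [norm_div, norm_pow, Complex.norm_real, Real.norm_of_nonneg Real.pi_pos.le]
      norm_num
    simp only [A, norm_mul, hn, hπ]
    ring
  calc Real.pi ^ 2 / 6 * ‖mellin (fun x : ℝ => h x) 2‖ * lam ^ 2 - A' / lam ^ 2
      ≤ ‖A‖ - ‖B‖ := by rw [hA]; linarith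
    _ ≤ ‖A - B‖ := norm_sub_norm_le A B

end quant

end Summit.RiemannHypothesis.RiemannHypothesis.Theorems.HandoffRouteE
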